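import Mathlib
import HarnessLib
import Summits.HubbardSuperconductivity.HubbardSuperconductivity.Theorems.WeakCouplingBCSKlCertTPrimePairEnergyNondegenerate

/-!
# Route `WeakCouplingBCS` — certificate half of stmt-HubbardSuperconductivity-0158, item (N3)′ of «TPRIME-LINDHARD-HS» (pen (R475)(A)), file F3a:
# UNIFORM second-order nondegeneracy of the `t′` pair energy, with margins (compactness)

Cell `gate-hubbard-kl`, seat p4 (g24); zero kit; no definitions.  The `t′`-twin of `Literature…exists_uniform_nondegeneracy` at FIXED `(t′, μ)` on the
Γ-window, under the two per-cell hypotheses `hN` (strict convexity along the chart) and `hlev` (level points are chart points mod `2π`) of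
`kltpPairE_nondegenerate` (file F2b):

**Theorem** (`kltp_exists_uniform_nondegeneracy`).  There are `c > 0` and a margin `0 < ℓ ≤ π` such that for every `p ∈ ℝ²` and every base point
`(θ₀, φ₀) ∈ [−π, π]²`, ONE of the six quantities `G, ∂_θG, ∂_φG, ∂²_θG, ∂²_φG, (∂_θ+∂_φ)²G` (`G = kltpPairE tp μ p`) is `≥ c` in absolute value on the
whole `ℓ`-box `|θ − θ₀| ≤ ℓ`, `|φ − φ₀| ≤ ℓ` (the maximum of the six absolute values is a positive continuous function of `(p, θ, φ)`, hence bounded below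
on the compact period box, and the six functions are uniformly continuous there; `p` is reduced modulo `2π`).

Honest framing: nothing here asserts `hN`/`hlev` at any cell, (N3)′, an HS row, a margin, `K₃`, `U₀`, the window or superconductivity; a Kohn–Luttinger
`O(U²)` channel statement is not ODLRO; nothing here proves superconductivity in the Hubbard model.
References: E. M. Stein, *Harmonic Analysis* (1993), Ch. VIII §1; G. Benfatto, A. Giuliani, V. Mastropietro, Ann. Henri Poincaré 7 (2006) 809, §1.
-/

noncomputable section

-- the tree's namespace `Summit.<Summit>.<Problem>.Theorems` repeats the summit name by design (D-0017)
set_option linter.dupNamespace false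

namespace Summit.HubbardSuperconductivity.HubbardSuperconductivity.Theorems

open Real Set Filter Literature.MathematicalPhysics.QuantumLattice KlTPrimeConvexity
open scoped Topology

section Window

variable {tp μ : ℝ} (htp : |tp| < 1 / 2) (hμ₁ : -4 - 4 * tp < μ) (hμ₂ : μ < 4 * tp)
include htp hμ₁ hμ₂

/-- **Uniform second-order nondegeneracy with margins** for the `t′` pair energy at fixed `(t′, μ)`. [cite: BenfattoGiulianiMastropietro2006, §1 (1.5)] -/
theorem kltp_exists_uniform_nondegeneracy (hN : ∀ θ : ℝ, 0 < curvNum tp (kltpX tp μ θ) (kltpY tp μ θ))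
    (hlev : ∀ X Y : ℝ, -2 * 1 * (Real.cos X + Real.cos Y) - 4 * tp * Real.cos X * Real.cos Y = μ →
      ∃ ψ : ℝ, Real.cos X = Real.cos (kltpPolar tp μ ψ 0) ∧ Real.sin X = Real.sin (kltpPolar tp μ ψ 0) ∧
        Real.cos Y = Real.cos (kltpPolar tp μ ψ 1) ∧ Real.sin Y = Real.sin (kltpPolar tp μ ψ 1)) :
    ∃ c ℓ : ℝ, 0 < c ∧ 0 < ℓ ∧ ℓ ≤ π ∧ ∀ p : ℝ × ℝ, ∀ θ₀ ∈ Icc (-π) π, ∀ φ₀ ∈ Icc (-π) π,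
      (∀ θ φ, |θ - θ₀| ≤ ℓ → |φ - φ₀| ≤ ℓ → c ≤ |kltpPairE tp μ p θ φ|) ∨
      (∀ θ φ, |θ - θ₀| ≤ ℓ → |φ - φ₀| ≤ ℓ → c ≤ |kltpPairE₁ tp μ p θ φ|) ∨
      (∀ θ φ, |θ - θ₀| ≤ ℓ → |φ - φ₀| ≤ ℓ → c ≤ |kltpPairE₂ tp μ p θ φ|) ∨
      (∀ θ φ, |θ - θ₀| ≤ ℓ → |φ - φ₀| ≤ ℓ → c ≤ |kltpPairE₁₁ tp μ p θ φ|) ∨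
      (∀ θ φ, |θ - θ₀| ≤ ℓ → |φ - φ₀| ≤ ℓ → c ≤ |kltpPairE₂₂ tp μ p θ φ|) ∨
      (∀ θ φ, |θ - θ₀| ≤ ℓ → |φ - φ₀| ≤ ℓ → c ≤ |kltpPairEdd tp μ p θ φ|) := by
  -- the six functions on the parameter space `(p, θ, φ)`
  obtain ⟨hE0, hE1, hE2, hE11, hE22, hEdd⟩ := continuous_kltpPairE_all htp hμ₁ hμ₂
  set E0 : (ℝ × ℝ) × ℝ × ℝ → ℝ := fun z => kltpPairE tp μ z.1 z.2.1 z.2.2 with hE0d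
  set E1 : (ℝ × ℝ) × ℝ × ℝ → ℝ := fun z => kltpPairE₁ tp μ z.1 z.2.1 z.2.2 with hE1d
  set E2 : (ℝ × ℝ) × ℝ × ℝ → ℝ := fun z => kltpPairE₂ tp μ z.1 z.2.1 z.2.2 with hE2d
  set E3 : (ℝ × ℝ) × ℝ × ℝ → ℝ := fun z => kltpPairE₁₁ tp μ z.1 z.2.1 z.2.2 with hE3d
  set E4 : (ℝ × ℝ) × ℝ × ℝ → ℝ := fun z => kltpPairE₂₂ tp μ z.1 z.2.1 z.2.2 with hE4d
  set E5 : (ℝ × ℝ) × ℝ × ℝ → ℝ := fun z => kltpPairEdd tp μ z.1 z.2.1 z.2.2 with hE5d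
  set F : (ℝ × ℝ) × ℝ × ℝ → ℝ := fun z => max (max (max |E0 z| |E1 z|) (max |E2 z| |E3 z|)) (max |E4 z| |E5 z|) with hF
  have hFc : Continuous F := by
    have a0 : Continuous (fun z => |E0 z|) := continuous_abs.comp hE0
    have a1 : Continuous (fun z => |E1 z|) := continuous_abs.comp hE1
    have a2 : Continuous (fun z => |E2 z|) := continuous_abs.comp hE2
    have a3 : Continuous (fun z => |E3 z|) := continuous_abs.comp hE11
    have a4 : Continuous (fun z => |E4 z|) := continuous_abs.comp hE22
    have a5 : Continuous (fun z => |E5 z|) := continuous_abs.comp hEdd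
    exact ((a0.max a1).max (a2.max a3)).max (a4.max a5)
  have hFpos : ∀ z, 0 < F z := by
    intro z
    by_contra hle
    push Not at hle
    have h0 : |E0 z| ≤ 0 := le_trans (le_max_left _ _ |>.trans (le_max_left _ _) |>.trans (le_max_left _ _)) hle
    have h1 : |E1 z| ≤ 0 := le_trans (le_max_right _ _ |>.trans (le_max_left _ _) |>.trans (le_max_left _ _)) hle
    have h2 : |E2 z| ≤ 0 := le_trans (le_max_left _ _ |>.trans (le_max_right _ _) |>.trans (le_max_left _ _)) hle
    have h3 : |E3 z| ≤ 0 := le_trans (le_max_right _ _ |>.trans (le_max_right _ _) |>.trans (le_max_left _ _)) hle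
    have h4 : |E4 z| ≤ 0 := le_trans (le_max_left _ _ |>.trans (le_max_right _ _)) hle
    have h5 : |E5 z| ≤ 0 := le_trans (le_max_right _ _ |>.trans (le_max_right _ _)) hle
    have e0 := abs_nonpos_iff.1 h0; have e1 := abs_nonpos_iff.1 h1; have e2 := abs_nonpos_iff.1 h2
    have e3 := abs_nonpos_iff.1 h3; have e4 := abs_nonpos_iff.1 h4; have e5 := abs_nonpos_iff.1 h5
    exact kltpPairE_nondegenerate htp hμ₁ hμ₂ hN hlev z.1 z.2.1 z.2.2 ⟨e0, e1, e2, e3, e4, e5⟩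
  -- the compact period box (with margins in `θ, φ`)
  set K : Set ((ℝ × ℝ) × ℝ × ℝ) := (Icc (-π) π ×ˢ Icc (-π) π) ×ˢ (Icc (-(2 * π)) (2 * π) ×ˢ Icc (-(2 * π)) (2 * π)) with hK
  have hKc : IsCompact K := (isCompact_Icc.prod isCompact_Icc).prod (isCompact_Icc.prod isCompact_Icc)
  have hKne : K.Nonempty := ⟨((0, 0), 0, 0),
    ⟨⟨by constructor <;> linarith [Real.pi_pos], by constructor <;> linarith [Real.pi_pos]⟩,
     ⟨by constructor <;> linarith [Real.pi_pos], by constructor <;> linarith [Real.pi_pos]⟩⟩⟩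
  obtain ⟨z₀, hz₀, hmin⟩ := hKc.exists_isMinOn hKne hFc.continuousOn
  set c₀ : ℝ := F z₀ with hc₀
  have hc₀pos : 0 < c₀ := hFpos z₀
  have hFge : ∀ z ∈ K, c₀ ≤ F z := fun z hz => hmin hz
  -- uniform continuity of the six functions on `K`
  have huc : ∀ {E : (ℝ × ℝ) × ℝ × ℝ → ℝ}, Continuous E →
      ∃ δ > 0, ∀ z ∈ K, ∀ z' ∈ K, dist z z' < δ → dist (E z) (E z') < c₀ / 2 := by
    intro E hE
    have h := hKc.uniformContinuousOn_of_continuous hE.continuousOn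
    rw [Metric.uniformContinuousOn_iff] at h
    exact h (c₀ / 2) (half_pos hc₀pos)
  obtain ⟨δ0, hδ0, hu0⟩ := huc hE0
  obtain ⟨δ1, hδ1, hu1⟩ := huc hE1
  obtain ⟨δ2, hδ2, hu2⟩ := huc hE2
  obtain ⟨δ3, hδ3, hu3⟩ := huc hE11
  obtain ⟨δ4, hδ4, hu4⟩ := huc hE22
  obtain ⟨δ5, hδ5, hu5⟩ := huc hEdd
  set δ : ℝ := min (min (min δ0 δ1) (min δ2 δ3)) (min δ4 δ5) with hδ
  have hδpos : 0 < δ := by rw [hδ]; positivity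
  have hδle : δ ≤ δ0 ∧ δ ≤ δ1 ∧ δ ≤ δ2 ∧ δ ≤ δ3 ∧ δ ≤ δ4 ∧ δ ≤ δ5 := by
    rw [hδ]
    refine ⟨?_, ?_, ?_, ?_, ?_, ?_⟩
    · exact (min_le_left _ _).trans ((min_le_left _ _).trans (min_le_left _ _))
    · exact (min_le_left _ _).trans ((min_le_left _ _).trans (min_le_right _ _))
    · exact (min_le_left _ _).trans ((min_le_right _ _).trans (min_le_left _ _))
    · exact (min_le_left _ _).trans ((min_le_right _ _).trans (min_le_right _ _))
    · exact (min_le_right _ _).trans (min_le_left _ _)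
    · exact (min_le_right _ _).trans (min_le_right _ _)
  set ℓ : ℝ := min π (δ / 2) with hℓ
  have hℓpos : 0 < ℓ := lt_min Real.pi_pos (half_pos hδpos)
  have hℓπ : ℓ ≤ π := min_le_left _ _
  have hℓδ : ℓ < δ := (min_le_right _ _).trans_lt (half_lt_self hδpos)
  refine ⟨c₀ / 2, ℓ, half_pos hc₀pos, hℓpos, hℓπ, fun p θ₀ hθ₀ φ₀ hφ₀ => ?_⟩
  -- reduce `p` and set up the two points of `K`
  obtain ⟨q, hq, hred⟩ := kltpPairE_all_reduce tp μ p
  have hmemK : ∀ θ φ, |θ - θ₀| ≤ ℓ → |φ - φ₀| ≤ ℓ → ((q, θ, φ) : (ℝ × ℝ) × ℝ × ℝ) ∈ K := by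
    intro θ φ hθ hφ
    refine ⟨hq, ?_, ?_⟩
    · have := abs_le.1 hθ
      exact ⟨by linarith [hθ₀.1], by linarith [hθ₀.2]⟩
    · have := abs_le.1 hφ
      exact ⟨by linarith [hφ₀.1], by linarith [hφ₀.2]⟩
  have hz₁ : ((q, θ₀, φ₀) : (ℝ × ℝ) × ℝ × ℝ) ∈ K := hmemK θ₀ φ₀ (by simp [hℓpos.le]) (by simp [hℓpos.le])
  have hdist : ∀ θ φ, |θ - θ₀| ≤ ℓ → |φ - φ₀| ≤ ℓ → dist ((q, θ, φ) : (ℝ × ℝ) × ℝ × ℝ) (q, θ₀, φ₀) < δ := by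
    intro θ φ hθ hφ
    rw [Prod.dist_eq]
    refine max_lt (by rw [dist_self]; exact hδpos) ?_
    rw [Prod.dist_eq, Real.dist_eq, Real.dist_eq]
    exact max_lt (hθ.trans_lt hℓδ) (hφ.trans_lt hℓδ)
  -- transfer of a lower bound at the base point to the box
  have key : ∀ {E : (ℝ × ℝ) × ℝ × ℝ → ℝ} {δE : ℝ},
      (∀ z ∈ K, ∀ z' ∈ K, dist z z' < δE → dist (E z) (E z') < c₀ / 2) → δ ≤ δE →
      c₀ ≤ |E (q, θ₀, φ₀)| →
      ∀ θ φ, |θ - θ₀| ≤ ℓ → |φ - φ₀| ≤ ℓ → c₀ / 2 ≤ |E (q, θ, φ)| := by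
    intro E δE hu hle hbase θ φ hθ hφ
    have hd := hu _ (hmemK θ φ hθ hφ) _ hz₁ ((hdist θ φ hθ hφ).trans_le hle)
    rw [Real.dist_eq] at hd
    have := abs_sub_abs_le_abs_sub (E (q, θ₀, φ₀)) (E (q, θ, φ))
    rw [abs_sub_comm] at hd
    linarith
  -- which of the six is large at the base point
  have hsel : c₀ ≤ |E0 (q, θ₀, φ₀)| ∨ c₀ ≤ |E1 (q, θ₀, φ₀)| ∨ c₀ ≤ |E2 (q, θ₀, φ₀)| ∨
      c₀ ≤ |E3 (q, θ₀, φ₀)| ∨ c₀ ≤ |E4 (q, θ₀, φ₀)| ∨ c₀ ≤ |E5 (q, θ₀, φ₀)| := by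
    by_contra hneg
    push Not at hneg
    obtain ⟨n0, n1, n2, n3, n4, n5⟩ := hneg
    have hlt : F (q, θ₀, φ₀) < c₀ := max_lt (max_lt (max_lt n0 n1) (max_lt n2 n3)) (max_lt n4 n5)
    linarith [hFge _ hz₁]
  rcases hsel with h | h | h | h | h | h
  · refine Or.inl fun θ φ hθ hφ => ?_
    rw [← (hred θ φ).1]; exact key hu0 hδle.1 h θ φ hθ hφ
  · refine Or.inr (Or.inl fun θ φ hθ hφ => ?_)
    rw [← (hred θ φ).2.1]; exact key hu1 hδle.2.1 h θ φ hθ hφ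
  · refine Or.inr (Or.inr (Or.inl fun θ φ hθ hφ => ?_))
    rw [← (hred θ φ).2.2.1]; exact key hu2 hδle.2.2.1 h θ φ hθ hφ
  · refine Or.inr (Or.inr (Or.inr (Or.inl fun θ φ hθ hφ => ?_)))
    rw [← (hred θ φ).2.2.2.1]; exact key hu3 hδle.2.2.2.1 h θ φ hθ hφ
  · refine Or.inr (Or.inr (Or.inr (Or.inr (Or.inl fun θ φ hθ hφ => ?_))))
    rw [← (hred θ φ).2.2.2.2.1]; exact key hu4 hδle.2.2.2.2.1 h θ φ hθ hφ
  · refine Or.inr (Or.inr (Or.inr (Or.inr (Or.inr fun θ φ hθ hφ => ?_))))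
    rw [← (hred θ φ).2.2.2.2.2]; exact key hu5 hδle.2.2.2.2.2 h θ φ hθ hφ

end Window

end Summit.HubbardSuperconductivity.HubbardSuperconductivity.Theorems

end
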